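import Mathlib.MeasureTheory.Order.Group.Lattice
import Literature.Probability.LatticeModels.CoarseCellFiniteSize
import Literature.Probability.LatticeModels.CoarseCellMixingDLR
import HarnessLib

/-!
# Counting on the coarse torus of cells; the perturbed finite-size condition; bad shells

Second companion ("theorems only") file of
`Literature/Probability/LatticeModels/CoarseCellFiniteSize.lean` (vocabulary `CoarseIdx`, `cdist`,
`shellCount`, `cellCount`, `IsGoodFS`, `IsLocallyAC`, `PeierlsRare`):

* `cdist_triangle` — the `ℓ^∞` cyclic distance is a pseudometric;
* `card_filter_cdist_le`, `card_filter_cdist_le_eq` — a cube of radius `R` on the coarse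
  `d`-torus has `≤ (2R+1)^d` cells, exactly so once every side has `≥ 2R+1` cells;
  `card_shell_le_shellCount` — the shell `cdist = 2n+1` has `≤ shellCount d n` cells (the branching
  number of the Dobrushin–Shlosman block recursion); `cellCount_le_of_subset_cube`;
* `isGoodFS_of_isLocallyAC` — the good-exterior finite-size condition passes from a reference
  specification `γ₀` to a locally absolutely continuous perturbation `γ` with
  `ε = ε₀ + 2(e^{ε₁(4n+1)^d} - 1)`;
* `measurableSet_badShell`, `measureReal_badShell_le` — the bad-shell event and its Peierls bound
  `≤ shellCount d n · p` under a measure with Peierls-rare bad cells.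

## References

* R. L. Dobrushin, S. B. Shlosman, *Constructive criterion for the uniqueness of Gibbs field*
  (1985), §2.
* H.-O. Georgii, *Gibbs Measures and Phase Transitions*, 2nd ed. (de Gruyter 2011), Ch. 8.
-/

noncomputable section

open _root_.MeasureTheory
open scoped ENNReal

namespace Literature.Probability.LatticeModels

variable {d : ℕ} {μc : Fin d → ℕ}

/-! ### The `ℓ^∞` cyclic distance and cube / shell counts -/

/-- Triangle inequality for the `ℓ^∞` cyclic distance (coordinatewise
`ZMod.natAbs_valMinAbs_add_le`). [folklore] -/
theorem cdist_triangle (x y z : CoarseIdx μc) : cdist x z ≤ cdist x y + cdist y z := by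
  unfold cdist
  refine Finset.sup_le fun i _ => ?_
  have key : ((x i - z i).valMinAbs).natAbs ≤
      ((x i - y i).valMinAbs).natAbs + ((y i - z i).valMinAbs).natAbs := by
    have hsum := ZMod.natAbs_valMinAbs_add_le (x i - y i) (y i - z i)
    rw [sub_add_sub_cancel] at hsum
    exact hsum.trans (Int.natAbs_add_le _ _)
  exact key.trans (add_le_add
    (Finset.le_sup (f := fun i : Fin d => ((x i - y i).valMinAbs).natAbs) (Finset.mem_univ i))
    (Finset.le_sup (f := fun i : Fin d => ((y i - z i).valMinAbs).natAbs) (Finset.mem_univ i)))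

/-- `cdist` is symmetric (`valMinAbs (-a)` and `valMinAbs a` have the same absolute value).
[folklore] -/
theorem cdist_comm (x y : CoarseIdx μc) : cdist x y = cdist y x := by
  unfold cdist
  congr 1
  funext i
  rw [← neg_sub (x i) (y i), ZMod.natAbs_valMinAbs_neg]

/-- **Cube count on the coarse torus**: at most `(2R+1)^d` cells lie within `ℓ^∞` cyclic distance
`R` of a given cell (inject `c' ↦ ((c i - c' i).valMinAbs)_i` into `[-R, R]^d ⊆ ℤ^d`).
[folklore] -/
theorem card_filter_cdist_le (c : CoarseIdx μc) (R : ℕ) :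
    (Finset.univ.filter fun c' : CoarseIdx μc => cdist c c' ≤ R).card ≤ (2 * R + 1) ^ d := by
  set T : Finset (Fin d → ℤ) := Fintype.piFinset fun _ => Finset.Icc (-(R : ℤ)) R with hT
  have hTcard : T.card = (2 * R + 1) ^ d := by
    rw [hT, Fintype.card_piFinset, Finset.prod_const, Finset.card_univ, Fintype.card_fin,
      Int.card_Icc]
    congr 1
    omega
  rw [← hTcard]
  refine Finset.card_le_card_of_injOn (fun c' i => (c i - c' i).valMinAbs) ?_ ?_
  · intro c' hc'
    have hc'R : Finset.univ.sup (fun i : Fin d => ((c i - c' i).valMinAbs).natAbs) ≤ R :=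
      (Finset.mem_filter.1 (Finset.mem_coe.1 hc')).2
    rw [Finset.mem_coe, hT, Fintype.mem_piFinset]
    intro i
    dsimp only
    rw [Finset.mem_Icc]
    have hi : ((c i - c' i).valMinAbs).natAbs ≤ R :=
      le_trans (Finset.le_sup (f := fun i : Fin d => ((c i - c' i).valMinAbs).natAbs)
        (Finset.mem_univ i)) hc'R
    constructor <;> omega
  · intro c₁ _ c₂ _ heq
    funext i
    have hi : (c i - c₁ i).valMinAbs = (c i - c₂ i).valMinAbs := congr_fun heq i
    have h' : c i - c₁ i = c i - c₂ i := by
      rw [← ZMod.coe_valMinAbs (c i - c₁ i), ← ZMod.coe_valMinAbs (c i - c₂ i), hi]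
    exact sub_right_injective h'

/-- **Exact cube count** when every side of the coarse torus has at least `2R+1` cells: the
injection of `card_filter_cdist_le` is onto `[-R, R]^d` (for `|t| ≤ R < (μ_i+1)/2` the class of
`t` has `valMinAbs = t`, Mathlib `ZMod.valMinAbs_spec`). [folklore] -/
theorem card_filter_cdist_le_eq (c : CoarseIdx μc) (R : ℕ) (hμ : ∀ i, 2 * R + 1 ≤ μc i + 1) :
    (Finset.univ.filter fun c' : CoarseIdx μc => cdist c c' ≤ R).card = (2 * R + 1) ^ d := by
  refine le_antisymm (card_filter_cdist_le c R) ?_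
  set T : Finset (Fin d → ℤ) := Fintype.piFinset fun _ => Finset.Icc (-(R : ℤ)) R with hT
  have hTcard : T.card = (2 * R + 1) ^ d := by
    rw [hT, Fintype.card_piFinset, Finset.prod_const, Finset.card_univ, Fintype.card_fin,
      Int.card_Icc]
    congr 1
    omega
  rw [← hTcard]
  have hval : ∀ (i : Fin d) (t : ℤ), -(R : ℤ) ≤ t → t ≤ R →
      ((t : ZMod (μc i + 1)).valMinAbs = t) := by
    intro i t ht1 ht2
    have hm := hμ i
    rw [ZMod.valMinAbs_spec]
    refine ⟨rfl, ?_, ?_⟩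
    · push_cast; omega
    · push_cast; omega
  refine Finset.card_le_card_of_injOn (fun t i => c i - ((t i : ℤ) : ZMod (μc i + 1))) ?_ ?_
  · intro t ht
    rw [Finset.mem_coe, hT, Fintype.mem_piFinset] at ht
    rw [Finset.mem_coe, Finset.mem_filter]
    refine ⟨Finset.mem_univ _, Finset.sup_le fun i _ => ?_⟩
    have hti := Finset.mem_Icc.1 (ht i)
    dsimp only
    rw [sub_sub_cancel, hval i (t i) hti.1 hti.2]
    omega
  · intro t ht t' ht' heq
    rw [Finset.mem_coe, hT, Fintype.mem_piFinset] at ht ht'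
    funext i
    have hti := Finset.mem_Icc.1 (ht i)
    have ht'i := Finset.mem_Icc.1 (ht' i)
    have hi : c i - ((t i : ℤ) : ZMod (μc i + 1)) = c i - ((t' i : ℤ) : ZMod (μc i + 1)) :=
      congr_fun heq i
    rw [sub_right_inj] at hi
    rw [← hval i (t i) hti.1 hti.2, ← hval i (t' i) ht'i.1 ht'i.2, hi]

/-- **Shell count**: on a coarse torus with `≥ 4n+3` cells per side, the shell
`{c' | cdist c c' = 2n+1}` has at most `shellCount d n = (4n+3)^d - (4n+1)^d` cells.
[cite: DobrushinShlosman1985, §2] -/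
theorem card_shell_le_shellCount (c : CoarseIdx μc) (n : ℕ) (hμ : ∀ i, 4 * n + 3 ≤ μc i + 1) :
    (Finset.univ.filter fun c' : CoarseIdx μc => cdist c c' = 2 * n + 1).card ≤
      shellCount d n := by
  set Sh := Finset.univ.filter fun c' : CoarseIdx μc => cdist c c' = 2 * n + 1 with hSh
  set Q := Finset.univ.filter fun c' : CoarseIdx μc => cdist c c' ≤ 2 * n with hQ
  set Q' := Finset.univ.filter fun c' : CoarseIdx μc => cdist c c' ≤ 2 * n + 1 with hQ'
  have hdisj : Disjoint Sh Q := by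
    rw [Finset.disjoint_left]
    intro c' h1 h2
    rw [hSh, Finset.mem_filter] at h1
    rw [hQ, Finset.mem_filter] at h2
    omega
  have hsub : Sh.disjUnion Q hdisj ⊆ Q' := by
    intro c' hc'
    rw [Finset.mem_disjUnion] at hc'
    rw [hQ', Finset.mem_filter]
    rcases hc' with h | h
    · rw [hSh, Finset.mem_filter] at h
      exact ⟨h.1, h.2.le⟩
    · rw [hQ, Finset.mem_filter] at h
      exact ⟨h.1, by omega⟩
  have hsum : Sh.card + Q.card ≤ Q'.card := by
    rw [← Finset.card_disjUnion _ _ hdisj]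
    exact Finset.card_le_card hsub
  have h1 : Q'.card ≤ (4 * n + 3) ^ d := by
    have h := card_filter_cdist_le c (2 * n + 1)
    have e : 2 * (2 * n + 1) + 1 = 4 * n + 3 := by ring
    rwa [e] at h
  have h2 : Q.card = (4 * n + 1) ^ d := by
    have h := card_filter_cdist_le_eq c (2 * n) fun i => by have := hμ i; omega
    have e : 2 * (2 * n) + 1 = 4 * n + 1 := by ring
    rwa [e] at h
  rw [h2] at hsum
  exact Nat.le_sub_of_add_le (hsum.trans h1)

/-- `shellCount d n ≥ 1` in positive dimension. [folklore] -/
theorem one_le_shellCount [NeZero d] (n : ℕ) : 1 ≤ shellCount d n := by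
  unfold shellCount
  have h : (4 * n + 1) ^ d < (4 * n + 3) ^ d := Nat.pow_lt_pow_left (by omega) (NeZero.ne d)
  omega

variable {V S : Type*} [MeasurableSpace S]

/-- A cell-union inside the cube of radius `2n` meets at most `(4n+1)^d` cells. [folklore] -/
theorem cellCount_le_of_subset_cube [Fintype V] (cell : V → CoarseIdx μc) (c : CoarseIdx μc)
    (n : ℕ) (A : Finset V) (hA : ∀ v ∈ A, cdist c (cell v) ≤ 2 * n) :
    cellCount cell A ≤ (4 * n + 1) ^ d := by
  have h1 : cellCount cell A ≤
      (Finset.univ.filter fun c' : CoarseIdx μc => cdist c c' ≤ 2 * n).card := by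
    unfold cellCount
    refine Finset.card_le_card fun c' hc' => ?_
    rw [Finset.mem_filter] at hc' ⊢
    obtain ⟨v, hv, hvc⟩ := hc'.2
    exact ⟨Finset.mem_univ _, hvc ▸ hA v hv⟩
  have h2 := card_filter_cdist_le c (2 * n)
  have h3 : (2 * (2 * n) + 1) ^ d = (4 * n + 1) ^ d := by ring
  rw [h3] at h2
  exact h1.trans h2

/-! ### The perturbed finite-size condition -/

/-- **Good-exterior condition for the perturbed specification**: if `γ₀` satisfies
`IsGoodFS cell γ₀ good n ε₀` and `γ` is locally absolutely continuous w.r.t. `γ₀` at rate `ε₁ ≥ 0`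
per cell, then `γ` satisfies the same finite-size condition with
`ε = ε₀ + 2(e^{ε₁ (4n+1)^d} - 1)`: for `A` inside the cube (`≤ (4n+1)^d` cells) and `[0,1]`-valued
`f`, `γ_A f ≤ e^{ε₁ k} γ₀_A f ≤ γ₀_A f + (e^{ε₁ k} - 1)` and symmetrically from below.
[cite: Georgii2011, Ch. 8] -/
theorem isGoodFS_of_isLocallyAC [Fintype V] {cell : V → CoarseIdx μc}
    {γ γ₀ : Specification V S} (hγ : IsSpecification γ) (hγ₀ : IsSpecification γ₀)
    {good : CoarseIdx μc → Set (V → S)} {n : ℕ} {ε₀ ε₁ : ℝ} (hε₁ : 0 ≤ ε₁)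
    (hFS : IsGoodFS cell γ₀ good n ε₀) (hAC : IsLocallyAC cell γ γ₀ ε₁) :
    IsGoodFS cell γ good n (ε₀ + 2 * (Real.exp (ε₁ * ((4 * n + 1) ^ d : ℕ)) - 1)) := by
  refine ⟨hFS.good_local, hFS.good_meas, ?_⟩
  intro c A hAcube hAunion ζ ζ' hagree hgood f hf hf01 hfdep
  have h0 := abs_sub_le_iff.1 (hFS.fs c A hAcube hAunion ζ ζ' hagree hgood f hf hf01 hfdep)
  have hk : (cellCount cell A : ℝ) ≤ ((4 * n + 1) ^ d : ℕ) := by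
    exact_mod_cast cellCount_le_of_subset_cube cell c n A hAcube
  set E : ℝ := Real.exp (ε₁ * cellCount cell A) with hE
  have hE1 : 1 ≤ E := Real.one_le_exp (by positivity)
  have hEE' : E ≤ Real.exp (ε₁ * ((4 * n + 1) ^ d : ℕ)) :=
    Real.exp_le_exp.2 (mul_le_mul_of_nonneg_left hk hε₁)
  obtain ⟨haζ, hbζ⟩ := hAC A hAunion ζ f hf hf01
  obtain ⟨haζ', hbζ'⟩ := hAC A hAunion ζ' f hf hf01
  haveI := hγ.isProbability A ζ
  haveI := hγ.isProbability A ζ'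
  haveI := hγ₀.isProbability A ζ
  haveI := hγ₀.isProbability A ζ'
  obtain ⟨-, hx1⟩ := integral_mem_unitInterval (μ := γ A ζ) hf hf01
  obtain ⟨-, hx'1⟩ := integral_mem_unitInterval (μ := γ A ζ') hf hf01
  obtain ⟨-, hy1⟩ := integral_mem_unitInterval (μ := γ₀ A ζ) hf hf01
  obtain ⟨-, hy'1⟩ := integral_mem_unitInterval (μ := γ₀ A ζ') hf hf01
  have p1 := mul_le_of_le_one_right (sub_nonneg.2 hE1) hy1
  have p2 := mul_le_of_le_one_right (sub_nonneg.2 hE1) hx'1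
  have p3 := mul_le_of_le_one_right (sub_nonneg.2 hE1) hy'1
  have p4 := mul_le_of_le_one_right (sub_nonneg.2 hE1) hx1
  rw [abs_sub_le_iff]
  constructor
  · linarith [h0.1]
  · linarith [h0.2]

/-! ### The bad-shell event -/

/-- The bad-shell event "some cell at `cdist = 2n+1` from `c` meeting `Λ` is bad" is measurable
(a finite union of complements of the measurable good sets). [folklore] -/
theorem measurableSet_badShell [Fintype V] (cell : V → CoarseIdx μc)
    {good : CoarseIdx μc → Set (V → S)} (hgm : ∀ c, MeasurableSet (good c)) (c : CoarseIdx μc)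
    (n : ℕ) (Λ : Finset V) :
    MeasurableSet {σ : V → S | ∃ c', cdist c c' = 2 * n + 1 ∧ (∃ v ∈ Λ, cell v = c') ∧
      σ ∉ good c'} := by
  have hrepr : {σ : V → S | ∃ c', cdist c c' = 2 * n + 1 ∧ (∃ v ∈ Λ, cell v = c') ∧
      σ ∉ good c'} = ⋃ c' : CoarseIdx μc,
        {σ | (cdist c c' = 2 * n + 1 ∧ ∃ v ∈ Λ, cell v = c') ∧ σ ∉ good c'} := by
    ext σ
    simp only [Set.mem_setOf_eq, Set.mem_iUnion, and_assoc]
  rw [hrepr]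
  refine MeasurableSet.iUnion fun c' => ?_
  rw [Set.setOf_and]
  exact (MeasurableSet.const _).inter (hgm c').compl

/-- **Peierls bound for the bad-shell event**: under a measure with Peierls-rare bad cells at level
`p ≥ 0`, the event "some shell cell (`cdist = 2n+1`) meeting `Λ` is bad" has probability at most
`shellCount d n · p` (union bound over the `≤ shellCount d n` shell cells and `PeierlsRare` on
singletons). [folklore] -/
theorem measureReal_badShell_le [Fintype V] (cell : V → CoarseIdx μc)
    (good : CoarseIdx μc → Set (V → S)) {ν : Measure (V → S)} [IsFiniteMeasure ν] {p : ℝ}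
    (hp : 0 ≤ p) (hPei : PeierlsRare good ν p) (c : CoarseIdx μc) (n : ℕ)
    (hμ : ∀ i, 4 * n + 3 ≤ μc i + 1) (Λ : Finset V) :
    ν.real {σ | ∃ c', cdist c c' = 2 * n + 1 ∧ (∃ v ∈ Λ, cell v = c') ∧ σ ∉ good c'} ≤
      shellCount d n * p := by
  set Sh := Finset.univ.filter fun c' : CoarseIdx μc => cdist c c' = 2 * n + 1 with hSh
  set Bad : Set (V → S) :=
    {σ | ∃ c', cdist c c' = 2 * n + 1 ∧ (∃ v ∈ Λ, cell v = c') ∧ σ ∉ good c'} with hBad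
  have hsub : Bad ⊆ ⋃ c' ∈ Sh, {σ : V → S | ∀ e ∈ ({c'} : Finset (CoarseIdx μc)), σ ∉ good e} := by
    intro σ hσ
    obtain ⟨c', hc', -, hng⟩ := hσ
    simp only [Set.mem_iUnion, Set.mem_setOf_eq]
    refine ⟨c', ?_, fun e he => ?_⟩
    · rw [hSh, Finset.mem_filter]
      exact ⟨Finset.mem_univ _, hc'⟩
    · rw [Finset.mem_singleton] at he
      subst he
      exact hng
  have h1 : ν Bad ≤ ∑ c' ∈ Sh, ν {σ : V → S | ∀ e ∈ ({c'} : Finset (CoarseIdx μc)), σ ∉ good e} :=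
    (measure_mono hsub).trans (measure_biUnion_finset_le Sh _)
  have h2 : ∑ c' ∈ Sh, ν {σ : V → S | ∀ e ∈ ({c'} : Finset (CoarseIdx μc)), σ ∉ good e} ≤
      ∑ c' ∈ Sh, ENNReal.ofReal p :=
    Finset.sum_le_sum fun c' _ => by simpa using hPei {c'}
  have h3 : ∑ c' ∈ Sh, ENNReal.ofReal p = (Sh.card : ℝ≥0∞) * ENNReal.ofReal p := by
    rw [Finset.sum_const, nsmul_eq_mul]
  have hcard : (Sh.card : ℝ) ≤ shellCount d n := by
    exact_mod_cast card_shell_le_shellCount c n hμ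
  have hne : (Sh.card : ℝ≥0∞) * ENNReal.ofReal p ≠ ∞ :=
    ENNReal.mul_ne_top (ENNReal.natCast_ne_top _) ENNReal.ofReal_ne_top
  calc ν.real Bad = (ν Bad).toReal := measureReal_def _ _
    _ ≤ ((Sh.card : ℝ≥0∞) * ENNReal.ofReal p).toReal :=
        ENNReal.toReal_mono hne (h1.trans (h2.trans h3.le))
    _ = Sh.card * p := by
        rw [ENNReal.toReal_mul, ENNReal.toReal_natCast, ENNReal.toReal_ofReal hp]
    _ ≤ shellCount d n * p := mul_le_mul_of_nonneg_right hcard hp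

end Literature.Probability.LatticeModels
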